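import Summits.CriticalPhenomena.PercolationContinuityZ3.Theorems.FK.Transplant.KNFreeTargetStepIVSupplier
import Summits.CriticalPhenomena.PercolationContinuityZ3.Theorems.FK.Transplant.UFSC0TargetMatrices
import Summits.CriticalPhenomena.PercolationContinuityZ3.Theorems.PercNearOneGluingNoHeavyQuantEffectiveTargetLemma
import HarnessLib

/-!
# FRONTIER TRANSPLANT, binder 2 (TP_FK): INSTANCES of the Step-IV supplier interface `FKStepIVAt` — the comparison
# supplier of the Bernoulli window (T2w's Step IV, by Lemmas 7 and 9 at `p̃` and F1) and the record's conclusion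
# `∃ r, UFSC0` from suppliers for the box families

Support file (`--supports stmt-CriticalPhenomena-4575`, helper) of the FRONTIER TRANSPLANT sub-cell
(`fk-continuity/transplant/`, seat `prim-bschramm-fkt-p3`); builds on p205010 (kernel theorem, internal audit signed;
external expert review pending). No definitions, no named facts, no sorries; standard axioms.
Registered R62 (cell INBOX l.4588, 2026-08-23); registry row T2s; lead label T2s-B (fkt-lead L21, l.4604).

HONEST FRAMING (page 1, cell rule). The transplant's theorem of record `ufsc0_of_freeBoundaryHypothesis_r3`
(p248245, END STATE « 2 / 0 ☑ ») is CONDITIONAL on FH AND on TP_FK = `KNFreeTargetHittable d q p`, both OPEN at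
the same `p` for `q > 1` near `p_c(q)` (⇔ GRC Conj. (5.103) via K1; barrier note
`Literature.Barriers.CriticalPhenomena.SamePFreeBoundaryCriteria`, FBN-01, cited first); the transplant is a typed
reduction, not a proof of FK continuity, and THIS FILE DOES NOT CHANGE THAT. It shows that the interface
`FKStepIVAt` of `KNFreeTargetStepIVSupplier.lean` is INHABITED exactly where the tree already has Step IV (the
Bernoulli window, by comparison — T2w's Step-IV block, repackaged) and composes the two abstraction files into the
record's conclusion from suppliers. NOT `KNFreeTargetHittable`, NOT a binder discharge, NOT `_r4`; nothing at
`p ↓ p_c(q)`; `_r3` « 2 / 0 ☑ », n_open = 2, BINDER-OWNERS, FO-19 NO-GO unchanged.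

* `ufaceX_subset_layer_one`, `fkStepIVAt_of_collar` — **suppliers on collar shells**: the face `U(x)` lies in layer 1
  of `B⟨j⟩`, so the collar `B⟨j-1⟩ \\ B⟨j-1-N⟩` of ANY width `N ≥ 1` meets the interface's shell conditions; a supplier on
  a collar only has to prove the relay bound.
* `exists_fkStepIVAt_of_isHittable_comparison` — **the comparison supplier**: for `q ≥ 1`, a comparison density
  `p̃` with `p̃·q·(1-p) ≤ p·(1-p̃)`, `θ(p̃) > 0`, and a finite family `H` of `P_{p̃}`-hittable geometries, at every
  tolerance `δ > 0` there are `M j₀ R₀` with `FKStepIVAt q p δ H M j₀ R₀` — window half-side `M` from Lemma 7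
  (`exists_forall_le_lt_real_uniqZone`) and Lemma 9 (`exists_forall_lt_real_linked_orthantFace`) at tolerance `δ²`
  under `P_{p̃}`, shell = the `(2M+1)`-collar `B⟨j-1⟩ \ B⟨j-2M-2⟩`, levels `j ≥ 2M+2`, inflation `R ≥ M + ℓ_max + 1`,
  and at each contact F1 `stepIV_in_fkLaw_of_comparison`. (T2w `fkTargetAt_of_isHittable_comparison` =
  `fkTargetAt_of_fkStepIV` ∘ this.)
* `exists_fkStepIVAt_of_isHittable_ratio` — the same at `p̃ = p/(p+q(1-p))`.
* `ufsc0_of_fkStepIV` — **the record's conclusion from Step-IV suppliers for the box families**: suppliers at every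
  tolerance for `qfList d` and for every `elongList d K` (`K ≥ 2`), plus FK-hittability of the aspect-`6` elongated
  geometries, give `∃ r, UFSC0 d q p r ε₀` (`d ≥ 3`, `q ≥ 1`, `0 < p < 1`): `ufsc0_of_boxTargetMatrix` ∘
  `fkTargetAt_of_fkStepIV` (the tolerance `δ(ε)` of the skeleton does not depend on the family, which is exactly the
  uniformity in the aspect that the matrix assembly needs). For the MEMO row T4-SLAB (R60) this is (P4)+(P6) modulo
  "FKStepIVAt from `Π(p,L)` for `IsBoxGeom` families" and (P5) at `K = 6`.

References: G. Kozma, S. Nitzan, arXiv:2401.12397 (2024), §4 Lemmas 7, 9, 10 (pp. 13–22), Theorem 6 (pp. 25–26)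
[KozmaNitzan2024]; G. Grimmett, *The Random-Cluster Model*, Springer 2006, Thm. (3.21) eq. (3.23), Conj. (5.103)
[Grimmett2006].
-/

noncomputable section

open MeasureTheory
open scoped ENNReal Classical

namespace Summit.CriticalPhenomena.PercolationContinuityZ3.Theorems.FK

open Literature.Probability.Percolation Literature.Probability.LatticeModels SimpleGraph
open Literature.Probability.Percolation.GadgetSystem Literature.Probability.Percolation.KozmaNitzan Transplant

variable {d : ℕ}

/-! ### Suppliers on collar shells -/

/-- **The face `U(x)` behind a potential contact lies in layer 1 of `B⟨j⟩`**: `L.ufaceX j M x ⊆ B⟨j-1⟩ \ B⟨j-2⟩`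
(`j ≥ 2`, wide level box): `U(x)` is the plaquette of `x = y + σ e_i` translated one step inward, so its
`i`-coordinate is `y_i - σ` with `y` on the `(i, σ)`-face. Hence EVERY collar `B⟨j-1⟩ \ B⟨j-1-N⟩`, `N ≥ 1`,
contains the faces of all potential contacts (T2w knew this only for the `(2M+1)`-collar, through the cube).
[cite: KozmaNitzan2024, §4 p. 21 (U(P), the plaquette translated inward)] -/
theorem ufaceX_subset_layer_one [NeZero d] {L : LData d} {j M : ℕ} (hj : 2 ≤ j)
    (hwide : ∀ k, L.Lo j k + 2 * M + 2 ≤ L.Hi j k) {x : Site d}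
    (hx : x ∈ outerBoundary (zdGraph d) (L.X j)) :
    L.ufaceX j M x ⊆ L.X (j - 1) \ L.X (j - 2) := by
  obtain ⟨h, -⟩ := LData.winData_spec hwide hx
  intro u hu
  rw [Finset.mem_sdiff]
  refine ⟨?_, fun hu2 => ?_⟩
  · have hu1 := uface_subset_shrink h hu
    rw [LData.Lo, LData.Hi, enlarge_lo_add_one (show 1 ≤ j by omega),
      enlarge_hi_sub_one (show 1 ≤ j by omega)] at hu1
    exact hu1
  · have hui := ((mem_uface_iff_cube h).1 hu).2
    rw [vctr_apply_self] at hui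
    rw [LData.X, ← enlarge_lo_add (t := 2) hj, ← enlarge_hi_sub (t := 2) hj, mem_Icc_iff] at hu2
    have h2 := hu2 (L.winData j M x).1
    have hface := h.face
    simp only [LData.Lo, LData.Hi, Pi.add_apply, Pi.sub_apply, Pi.natCast_apply] at h2 hface hui
    push_cast at h2
    rcases hface with ⟨hs, hy⟩ | ⟨hs, hy⟩
    · rw [hs, hy] at hui; omega
    · rw [hs, hy] at hui; omega

/-- **Suppliers on a collar shell.** To supply Step IV with the COLLAR `S = B⟨j-1⟩ \ B⟨j-1-N⟩` of any width
`N ≥ 1` (levels `j ≥ j₀ ≥ 2`) it suffices to prove the relay bound at every potential contact: the three shell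
conditions of the interface (`S ⊆ Icc (Lo j + 1) (Hi j - 1)`, `S ⊆ D`, `U(x) ⊆ S`) hold for every collar. The
comparison supplier uses `N = 2M+1`; the slab design of the memo row T4-SLAB uses `N = 2L+1` independent of `M`.
[cite: KozmaNitzan2024, §4 Lemma 10 Step IV (pp. 19–21: the shell S around ∂B⟨j⟩)] -/
theorem fkStepIVAt_of_collar [NeZero d] {q : ℝ} {p : unitInterval} {δ : ℝ} {H : List (Geom d)}
    {M j₀ R₀ : ℕ} (N : ℕ) (hN : 1 ≤ N) (hj₀ : 2 ≤ j₀)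
    (h : ∀ (L : LData d) (W : Sym2 (Site d) → unitInterval) (D T : Finset (Site d)) (R j : ℕ),
      LHyp L W p D (R - 1) → R₀ ≤ R → j₀ ≤ j → j + M + 2 ≤ R →
      (∀ k, L.Lo j k + 2 * M + 2 ≤ L.Hi j k) → IsTarget T L.lo L.hi D R H → T ⊆ D → T.Nonempty →
      ∀ x ∈ outerBoundary (zdGraph d) (L.X j),
        1 - 3 * δ ≤ (fkLaw L.Sfin (restrW (↑(L.X (j - 1) \ L.X (j - 1 - N)) : Set (Site d)) W) q).real
          {ω | ∃ u ∈ L.ufaceX j M x,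
            1 - δ < (fkLaw L.Sfin (pinW W (wireSet (↑(L.X (j - 1) \ L.X (j - 1 - N)) : Set (Site d))) ω) q).real
              (⋃ t ∈ T, openConnIn (↑D : Set (Site d)) u t)}) :
    FKStepIVAt q p δ H M j₀ R₀ := by
  intro L W D T R j hL hR₀ hj hjR hwide htgt hTD hTne
  refine ⟨L.X (j - 1) \ L.X (j - 1 - N), ?_, ?_, ?_, h L W D T R j hL hR₀ hj hjR hwide htgt hTD hTne⟩
  · intro z hz
    have hz1 := (Finset.mem_sdiff.1 hz).1
    rw [LData.X] at hz1
    rw [LData.Lo, LData.Hi, enlarge_lo_add_one (show 1 ≤ j by omega), enlarge_hi_sub_one (show 1 ≤ j by omega)]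
    exact hz1
  · exact Finset.sdiff_subset.trans (hL.X_subset_D (by omega))
  · intro x hx
    exact (ufaceX_subset_layer_one (by omega) hwide hx).trans
      (Finset.sdiff_subset_sdiff le_rfl (L.X_mono (by omega)))

/-! ### The comparison supplier (Bernoulli window) -/

/-- **The comparison Step-IV supplier.** For `q ≥ 1`, a density `p̃` with `p̃·q·(1-p) ≤ p·(1-p̃)` and `θ(p̃) > 0`,
`p̃ < 1`, a tolerance `δ > 0` and a finite family `H` of `P_{p̃}`-hittable geometries: `∃ M j₀ R₀, FKStepIVAt q p δ H M j₀ R₀`.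
This is T2w's Step-IV block as a stand-alone supplier: the scales `m ≤ M` from KN Lemma 9 (face orthants linked to
the seed inside `Λ_M`) and Lemma 7 (uniqueness zone) at tolerance `δ²` under `P_{p̃}`, the look thresholds of `H` at
`δ²`; shell `S = B⟨j-1⟩ \ B⟨j-2M-2⟩ ⊆ D` (contains every cube `v(P) + Λ_M`, hence every face `U(P)`); at a contact,
the target route from `v(P) ∈ B⟨R⟩` given by `IsTarget` at scale `ℓ ≥ R ≥ ℓ_max`, and F1
`stepIV_in_fkLaw_of_comparison` (Step IV at `q = 1` for the comparison product law, lifted by (3.23)).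
[cite: KozmaNitzan2024, §4 Lemma 7 (p. 13), Lemma 9 (p. 16), Lemma 10 Step IV (pp. 19–21); Grimmett2006, Thm. (3.21) eq. (3.23)] -/
theorem exists_fkStepIVAt_of_isHittable_comparison [NeZero d] {q : ℝ} (hq : 1 ≤ q) (p p' : unitInterval)
    (hcmp : (p' : ℝ) * (q * (1 - p)) ≤ (p : ℝ) * (1 * (1 - p')))
    (hθ : 0 < theta (zdGraph d) 0 p') (hp'1 : (p' : ℝ) < 1) {δ : ℝ} (hδ : 0 < δ)
    (H : List (Geom d)) (hH : ∀ g ∈ H, IsHittable p' g) :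
    ∃ M j₀ R₀ : ℕ, FKStepIVAt q p δ H M j₀ R₀ := by
  classical
  -- the scales `m`, `M` and the look thresholds (under `P_{p̃}`, tolerance `δ²`)
  have hη : 0 < δ ^ 2 := by positivity
  have hkl : ∀ g ∈ H, ∃ kl : ℕ × ℕ, ∀ m, kl.1 ≤ m → ∀ ℓ, kl.2 ≤ ℓ →
      1 - δ ^ 2 < (bondPercolation (zdGraph d) p').real (linkIn (↑(g.Qset ℓ 0)) (box d m) (g.Fset ℓ 0)) := by
    intro g hg
    obtain ⟨k, ℓ₀, h⟩ := (hH g hg).hit (δ ^ 2) hη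
    exact ⟨(k, ℓ₀), h⟩
  choose! kl hklspec using hkl
  have le_foldr_max_of_mem : ∀ {l : List ℕ} {a : ℕ}, a ∈ l → a ≤ l.foldr max 0 := by
    intro l
    induction l with
    | nil => intro a h; exact absurd h List.not_mem_nil
    | cons b l ih =>
      intro a h
      rw [List.foldr_cons]
      rcases List.mem_cons.1 h with rfl | h
      · exact le_max_left _ _
      · exact (ih h).trans (le_max_right _ _)
  set k₀ := (H.map fun g => (kl g).1).foldr max 0 with hk₀
  set ℓmax := (H.map fun g => (kl g).2).foldr max 0 with hℓmax
  have hk₀le : ∀ g ∈ H, (kl g).1 ≤ k₀ := fun g hg => le_foldr_max_of_mem (List.mem_map.2 ⟨g, hg, rfl⟩)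
  have hℓle : ∀ g ∈ H, (kl g).2 ≤ ℓmax := fun g hg => le_foldr_max_of_mem (List.mem_map.2 ⟨g, hg, rfl⟩)
  obtain ⟨m, hmk₀, n₁, hmn₁, hface⟩ := exists_forall_lt_real_linked_orthantFace p' hθ hp'1 hη k₀
  obtain ⟨n₂, huniq⟩ := exists_forall_le_lt_real_uniqZone p' m hη
  set M := max n₁ n₂ with hM
  have hmM : m ≤ M := (le_of_lt hmn₁).trans (le_max_left _ _)
  refine ⟨M, 2 * M + 2, M + ℓmax + 1, ?_⟩
  intro L W D T R j hL hR₀ hj₀ hjR hwide htgt hTD _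
  -- the shell: the `(2M+1)`-collar of `B⟨j⟩`
  set S := L.X (j - 1) \ L.X (j - (2 * M + 2)) with hSdef
  have hS : S ⊆ Finset.Icc (L.Lo j + 1) (L.Hi j - 1) := LData.shell_subset_shrink (by omega)
  have hSD : S ⊆ D := (Finset.sdiff_subset).trans (hL.X_subset_D (by omega))
  have hUS : ∀ x ∈ outerBoundary (zdGraph d) (L.X j), L.ufaceX j M x ⊆ S := by
    intro x hx
    obtain ⟨h, -⟩ := LData.winData_spec hwide hx
    refine (uface_subset_cube h).trans ?_
    change L.cubeX j M x ⊆ S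
    rw [LData.cubeX_eq_ball]
    exact LData.ball_vX_subset_shell hj₀ hwide hx
  refine ⟨S, hS, hSD, hUS, fun x hx => ?_⟩
  -- Step IV at the contact `x`, by comparison with `P_{p̃}` on `D`
  set V := restrW (↑D : Set (Site d)) (lattW d p') with hV
  have hsubV : IsSubbox V p' D := isSubbox_restrW_lattW D p'
  set v := L.vX j M x with hv
  have hballS : GM.ball v M ⊆ S := LData.ball_vX_subset_shell hj₀ hwide hx
  have hballD : (↑(GM.ball v M) : Set (Site d)) ⊆ ↑D := Finset.coe_subset.2 (hballS.trans hSD)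
  -- the target route from `v`
  have hvB : v ∈ Finset.Icc (L.lo - (R : Site d)) (L.hi + (R : Site d)) := by
    have := LData.vX_mem (L := L) (by omega) hwide hx
    exact Icc_enlarge_mono (show j - 1 ≤ R by omega) this
  obtain ⟨ℓ, hRℓ, g, hg, hQ, hF⟩ := htgt.hit v hvB
  have hMℓ : M < ℓ := lt_of_lt_of_le (by omega) hRℓ
  -- (1) uniqueness zone under `P_{p̃}` (Lemma 7)
  have h1 : 1 - δ ^ 2 < (prodBernoulli V).real (uniqZoneAt v m M) := by
    rw [hsubV.real_eq_bondPercolation (determinedBy_uniqZoneAt v m M (wireSet_mono hballD))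
      (measurableSet_uniqZoneAt v m M), real_uniqZoneAt_eq]
    exact huniq M (le_max_right _ _)
  -- (2) the face under `P_{p̃}` (Lemma 9)
  have h2 : 1 - δ ^ 2 < (prodBernoulli V).real (linkIn (↑(GM.ball v M)) (GM.ball v m) (L.ufaceX j M x)) := by
    obtain ⟨a, τ, hsubU⟩ := LData.orthantFace_image_subset_ufaceX hwide hx
    have hmono : linkIn (↑(GM.ball v M)) (GM.ball v m) ((orthantFace a τ M).image (· + v)) ⊆
        linkIn (↑(GM.ball v M)) (GM.ball v m) (L.ufaceX j M x) := linkIn_mono le_rfl le_rfl hsubU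
    refine lt_of_lt_of_le ?_ (measureReal_mono hmono (measure_ne_top _ _))
    rw [hsubV.real_eq_bondPercolation (determinedBy_linkIn _ _ _ (wireSet_mono hballD))]
    · have e1 : GM.ball v M = (box d M).image (· + v) := rfl
      have e2 : GM.ball v m = (box d m).image (· + v) := rfl
      rw [e1, e2, real_linkIn_image_add]
      exact hface M (le_max_left _ _) a τ
    · exact measurableSet_linkIn _ _ _
  -- (3) the target route under `P_{p̃}` (hittability at `p̃`)
  have h3 : 1 - δ ^ 2 < (prodBernoulli V).real (linkIn (↑(g.Qset ℓ v)) (GM.ball v m) (g.Fset ℓ v)) := by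
    rw [hsubV.real_eq_bondPercolation (determinedBy_linkIn _ _ _ (wireSet_mono (Finset.coe_subset.2 hQ)))
      (measurableSet_linkIn _ _ _)]
    have e2 : GM.ball v m = (box d m).image (· + v) := rfl
    rw [g.Qset_eq_image ℓ v, g.Fset_eq_image ℓ v, e2, real_linkIn_image_add]
    exact hklspec g hg m ((hk₀le g hg).trans hmk₀) ℓ ((hℓle g hg).trans (by omega))
  exact stepIV_in_fkLaw_of_comparison (Λ := L.Sfin) hq hL.sub hL.DS hSD hcmp hF hQ hmM hballS
    (LData.ufaceX_subset_innerBoundary hwide hx) (g.disjoint_Fset_ball hMℓ v) hδ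
    (Rg := (↑D : Set (Site d))) hballD (Finset.coe_subset.2 hQ) h1 h2 h3

/-- **The comparison supplier at `p̃ = p/(p+q(1-p))`**: for `q ≥ 1`, `p < 1` with `θ(p̃) > 0` and a finite family of
`P_{p̃}`-hittable geometries, a Step-IV supplier exists at every tolerance.
[cite: KozmaNitzan2024, §4 Lemma 10 Step IV (pp. 19–21); Grimmett2006, Thm. (3.21) eq. (3.23)] -/
theorem exists_fkStepIVAt_of_isHittable_ratio [NeZero d] {q : ℝ} (hq : 1 ≤ q) (p : unitInterval)
    (hp1 : (p : ℝ) < 1) (hθ : 0 < theta (zdGraph d) 0 ⟨(p : ℝ) / (p + q * (1 - p)), ratio_mem_Icc p.2 hq⟩)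
    {δ : ℝ} (hδ : 0 < δ) (H : List (Geom d))
    (hH : ∀ g ∈ H, IsHittable (⟨(p : ℝ) / (p + q * (1 - p)), ratio_mem_Icc p.2 hq⟩ : unitInterval) g) :
    ∃ M j₀ R₀ : ℕ, FKStepIVAt q p δ H M j₀ R₀ :=
  exists_fkStepIVAt_of_isHittable_comparison hq p _ (ratio_cond_density p.2 hq) hθ
    ((ratio_le_self p.2 hq).trans_lt hp1) hδ H hH

/-- **In the Bernoulli window the box families have Step-IV suppliers at every tolerance** (`d ≥ 1`, `q ≥ 1`,
`p < 1`, `θ(p̃) > 0`): the quarter faces `qfList d` by tree Lemma 9 at `p̃`, the elongated faces `elongList d K`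
(`K ≥ 2`) by tree Lemma 11 at `p̃` (from the tree's `q = 1` target property). The hypotheses of `ufsc0_of_fkStepIV`
are thus satisfiable for every `q ≥ 1`. [cite: KozmaNitzan2024, §4 Lemmas 9–11 (pp. 16–22); Grimmett2006, Thm. (3.21) eq. (3.23)] -/
theorem exists_fkStepIVAt_boxFamilies_of_theta_ratio_pos [NeZero d] {q : ℝ} (hq : 1 ≤ q)
    (p : unitInterval) (hp0 : 0 < (p : ℝ)) (hp1 : (p : ℝ) < 1)
    (hθ : 0 < theta (zdGraph d) 0 ⟨(p : ℝ) / (p + q * (1 - p)), ratio_mem_Icc p.2 hq⟩) {δ : ℝ} (hδ : 0 < δ) :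
    (∃ M j₀ R₀ : ℕ, FKStepIVAt q p δ (qfList d) M j₀ R₀) ∧
      ∀ (K : ℕ) (hK : 2 ≤ K), ∃ M j₀ R₀ : ℕ, FKStepIVAt q p δ (elongList d K (by omega)) M j₀ R₀ := by
  set p' : unitInterval := ⟨(p : ℝ) / (p + q * (1 - p)), ratio_mem_Icc p.2 hq⟩ with hp'
  have hp'0 : 0 < (p' : ℝ) := by
    show 0 < (p : ℝ) / (p + q * (1 - p))
    exact div_pos hp0 (by nlinarith [p.2.2, hp0])
  have hp'1 : (p' : ℝ) < 1 := (ratio_le_self p.2 hq).trans_lt hp1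
  have hTP' : TargetProperty d p' := Quant.targetProperty_of_theta_pos p' hp'0 hp'1 hθ
  refine ⟨exists_fkStepIVAt_of_isHittable_ratio hq p hp1 hθ hδ _ (isHittable_of_mem_qfList p' hθ hp'1),
    fun K hK => exists_fkStepIVAt_of_isHittable_ratio hq p hp1 hθ hδ _ ?_⟩
  exact isHittable_of_mem_elongList_of_target p' hTP' hp'1 hθ K hK

/-! ### The record's conclusion from suppliers for the box families -/

/-- **`∃ r, UFSC0 d q p r ε₀` from Step-IV suppliers for the box families** (`d ≥ 3`, `q ≥ 1`, `ε₀ > 0`,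
`0 < p < 1`): Step-IV suppliers at every tolerance `δ ∈ (0,1]` for the quarter faces `qfList d` and for every family
of elongated faces `elongList d K` (`K ≥ 2`), together with FK-hittability of the aspect-`6` elongated geometries,
give the record's conclusion. Proof: `fkTargetAt_of_fkStepIV` turns the suppliers into the two target matrices with
ONE tolerance map `δ(ε)` (independent of the family — the uniformity in the aspect `K`), and
`ufsc0_of_boxTargetMatrix` runs KN's Theorem-6 constants on them.
[cite: KozmaNitzan2024, §4 Lemma 10 (pp. 17–22), Theorem 6 (pp. 25–26); Grimmett2006, Conj. (5.103)] -/
theorem ufsc0_of_fkStepIV [NeZero d] (hd : 3 ≤ d) {q : ℝ} {ε₀ : ℝ} (hq : 1 ≤ q) (hε₀ : 0 < ε₀)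
    (p : unitInterval) (hp0 : 0 < (p : ℝ)) (hp1 : (p : ℝ) < 1)
    (hsq : ∀ ⦃δ : ℝ⦄, 0 < δ → δ ≤ 1 → ∃ M j₀ R₀ : ℕ, FKStepIVAt q p δ (qfList d) M j₀ R₀)
    (hse : ∀ ⦃δ : ℝ⦄, 0 < δ → δ ≤ 1 → ∀ (K : ℕ) (hK : 2 ≤ K), ∃ M j₀ R₀ : ℕ,
      FKStepIVAt q p δ (elongList d K (by omega)) M j₀ R₀)
    (hel6 : ∀ g ∈ elongList d 6 (by norm_num), IsHittableFK q p g) :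
    ∃ r : ℕ, UFSC0 d q p r ε₀ := by
  refine ufsc0_of_boxTargetMatrix hd hq hε₀ p (fun ε hε => ?_) hel6
  obtain ⟨δ, hδ, hδ1, h⟩ := fkTargetAt_of_fkStepIV (d := d) hq p hp0 hp1 hε
  refine ⟨δ, hδ, ?_, fun K hK => ?_⟩
  · obtain ⟨M, j₀, R₀, hs⟩ := hsq hδ hδ1
    exact h _ M j₀ R₀ hs
  · obtain ⟨M, j₀, R₀, hs⟩ := hse hδ hδ1 K hK
    exact h _ M j₀ R₀ hs

end Summit.CriticalPhenomena.PercolationContinuityZ3.Theorems.FK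

end
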